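import Summits.QuantumFields.YangMills.Theorems.BalabanUVNodesN11BgRowGaugeSocketsGB
import Literature.MathematicalPhysics.QuantumFieldTheory.Balaban1983to89.Node00.Record13LettersOfThm1CCMW
import Literature.MathematicalPhysics.QuantumFieldTheory.Balaban1983to89.Node00.LargeFieldBackgroundCoPOfRecordB

/-!
# DAG node N11 × K1 — ROW P11 `bg` AT K1's WITNESS `θ₁₅ᶜᶜᴹᵂ(j; γ)` ON EVERY WINDOW RUN, NO RUN GUARD, NO GEOMETRIC HYPOTHESIS LEFT: this seat's GaugeR re-thread
# (p623895, `hcubeΩ` as a hypothesis) ∘ dag-n11-w4 g4's «BG-ONEBLOCK» §1 `hcubeΩ_of_powM` (K0b's (1.12)-cube inclusion freed by the compatible-or-one-block dichotomy) ∘ A2ʷ's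
# window letter (C1) — for the non-wrapping families `j + 1 ≤ F.m`

SIBLING MODULE (director-ym №365 (2), RENAME-AND-REDIRECT; dag-n11-w1 g6): this NEW file `…RAtWitnessOfPowMB` carries the two RE-KEYED witness-level declarations of the residue module `…N11BgRowGaugeRAtWitnessOfPowM` (§2∕§3) under the SAME short names in the namespace `…Theorems.BalabanUVNodesN11BgRowGaugeRAtWitnessOfPowMB`; displayed [15] hypotheses = the ᴮ sentences at `(floorGuard F c, lamDatum F, Dat)` (R road: floor letter `hc` kept) + `{Dat}` + trailing `hDat`; CONCLUSIONS BYTE-IDENTICAL; proofs = ONE application of `…N11BgRowGaugeSocketsGB` §2a∕§2b at `(UbgMSCoPOfRecordB, lamDatum F, ubgMSCoPOfRecordB_dichotomy, UbgOfRecord₁₃CoP_succ)` (the socket discharges the (1.12)-cube inclusion by `hcubeΩ_of_powM` itself, so the residue module's §1 `hcube_theta13OfThm1CCMW_of_window` and the root's `hcube`-hypothesis rows §5∕§6 are NOT re-keyed — no green consumer; they stay residue).  Imports avoid every residue module.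

HEADER — WORK-UNIT METADATA.  Cell `pub-ymgap`, YM-PLAN Track A (HUMAN RULING D-0062 ∕ D-0149 ∕ D-0154 width seats), seat `pub-ymgap-dag-n11-w5` (g2; WIDTH SEAT 5 on NODE n11
[B14]; dag-lead ASSIGN-391 «n11-w5 TAKE the CoClassGauge ∕ GaugeR chain», INBOX l.35505, on plan g85's word l.35472), route `BalabanUVNodes` rev 27, item K1⁸
`StabilityBRunRowsAtRecordR13SepCoPH` = stmt-QuantumFields-26907 (helper lane, `--kind proof --supports 26907 --as helper`, count-neutral).  [III] = [Balaban1988Convergent],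
[I] = [Balaban1987RG1], [15] = [Balaban1985Variational], [6] = [Balaban1985RegularSpaces].  Over this seat's `…N11BgRowGaugeROfHcubeOmega` (§5 ★★★
`bgSepCoPAt_theta13OfThm1CCMW_of_thm1GaugeR_of_hcomp_of_hjm_of_hcubeΩ`, §6 ★★★ `bgProvisoΛ_theta13OfThm1CCMW_of_thm1GaugeR_of_hcomp_of_hjm_of_hcubeΩ`), dag-n11-w4 g4's
`…N11BgRowOfPowM` (★ `hcubeΩ_of_powM` — cited BY NAME, the one declarer of that statement), dag-n21-c's `Node00/Record13LettersOfThm1CCMW` (A2ʷ `hC1_theta13OfThm1CCMW`,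
`τ9_M_pos_theta13OfThm1CCMW`, `theta13OfThm1CCMW_τ9_M`).

WHY THIS FILE.  p623895 left ONE displayed geometric input `hcube` (K0b's `hcubeΩ` shape, run-indexed behind the window); dag-n11-w4's §1 discharges it at every power-of-`L` basic cube
from (C1) alone, and at the witness `M = L^j` (`rfl`) while (C1) `R_j = L·t_j` holds on every WINDOW run (`γ ≤ ½`, A2ʷ).  Composing the three BY NAME gives row P11's BODY and
its own-currency form `BgProvisoΛ … (suppOfRecord₁₃SepCoP …) (UbgOfRecord₁₃CoP …)` at `θ₁₅ᶜᶜᴹᵂ(j; γ)` on EVERY window run of EVERY length `n ≤ K` — above or below dag-n11-w4's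
coupling floor — with NO `PartCompat₁₃` and NO geometric hypothesis, for every non-wrapping family `j + 1 ≤ F.m` (the wrapping ones, `F.m ≤ j`, keep dag-n21-c's holonomy residue
`exists_wrap_witness_top`; out of scope).  This is the `hbg` of dag-n11-w1 g3's `…OfBgFact(s)` consumers at the witness, and the guard-free content of «BG-ONEBLOCK» on the road K1's
witness door reads (dag-n07-e g20 LOCATED-BG-ONEBLOCK-LETTER l.35893: the live letters are exactly this chain's (8)∕(9)).

WHAT THIS FILE PROVES (0 `sorry`, 0 `def`; three compositions BY NAME; nothing of Bałaban asserted).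
§1 `hcube_theta13OfThm1CCMW_of_window` (the run-indexed `hcube` of p623895 §5∕§6 at the witness, from `hcubeΩ_of_powM` ∘ `hC1_theta13OfThm1CCMW`) · §2 ★★★
`bgSepCoPAt_theta13OfThm1CCMW_of_thm1GaugeR_of_hcomp_of_hjm` (the (7)-guarded separated row P11 body on every window run — hypotheses: window letters, (8), (9), (hcomp)∧(hcompRev),
`hjm`; NOTHING geometric, NO run guard) · §3 ★★★ `bgProvisoΛ_theta13OfThm1CCMW_of_thm1GaugeR_of_hcomp_of_hjm` (the same in `BgProvisoΛ` currency).

HONEST FRAMING.  Helper lane of K1⁸; count-neutral composition; CONDITIONAL on the [15] letters (8) `VariationalThm1RegSepCoP7M` and (9) `VariationalThm1GaugeRegSepCoP7MR` (Props with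
parameters, inhabited nowhere — the ScaledSep letter refuted by dag-n21-c is NOT used), on (hcomp)∧(hcompRev), the window `0 < γ ≤ ½`, the six signs and `hjm : j + 1 ≤ F.m` — all
DISPLAYED; NOT a discharge; `Provisos₁₃SepCoPH.bg`'s type untouched.  N11 ∕ N07 NOT discharged; K0⁷ ∕ K1⁸ NOT closed; counts unmoved (typed 28∕28 · discharged 5∕27); no summit
statement is proved by this seat.  R4 closes only the conditional finite-𝕋⁴ rung `BalabanLadder.UV` of one programme at fixed `ε = L^{−K}` — NOT ℝ⁴, NOT OS, NOT a mass gap,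
NOT Clay.  No `sorry`, `axiom`, `def`, `instance`, `notation`.
Sources (SHAPE ∕ bookkeeping only): [III] (2.1) p.254, (2.5) p.255, p.257, (2.28) p.259, Thm 1 p.262; [I] (0.1) p.251, (1.12) p.262; [15] (6)–(7) p.278, Thm 1 (8)–(9) p.279; [6] (1.3)–(1.6) p.77.
-/

noncomputable section

open MeasureTheory
open scoped Matrix.Norms.L2Operator

namespace Summit.QuantumFields.YangMills.Theorems.BalabanUVNodesN11BgRowGaugeRAtWitnessOfPowMB

open Literature.MathematicalPhysics.QuantumFieldTheory.Balaban1983to89 Node00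
open T4Continuum B14.Eq218Concrete B15DeterminingSets FlowStep FlowStepRuns B12RegularSpaces111 B14RegularSpaces234 B14Radii T4AxialGaugeSmallField
open BalabanUVNodesN11BgRowGaugeSocketsGB

variable {F : T4Family} {N : ℕ} [NeZero N] {j c : ℕ} {γ ε₀ ε₂₉ B₃ B₃' a₀ a₁ : ℝ} {Dat : TopData F N}

/-- **§2 ★★★ THE (7)-GUARDED SEPARATED ROW P11 BODY AT θ₁₅ᶜᶜᴹᵂ(j; γ) ON EVERY WINDOW RUN — NO RUN GUARD, NO GEOMETRIC HYPOTHESIS** (p623895 §5 ∘ §1): for non-wrapping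
families `j + 1 ≤ F.m`, from the window letters, (8), (9), (hcomp) ∧ (hcompRev) ONLY.  CONDITIONAL; nothing of Bałaban asserted.
[cite: Balaban1985Variational, (6)–(7) p.278, Thm 1 (8)–(9) p.279; Balaban1988Convergent, Thm 1 p.262, (2.28) p.259, p.257; Balaban1987RG1, Thm 1 p.259, (1.12) p.262] -/
theorem bgSepCoPAt_theta13OfThm1CCMW_of_thm1GaugeR_of_hcomp_of_hjm (hγ0 : 0 < γ) (hγ : γ ≤ 1 / 2) (hjm : j + 1 ≤ F.m) (hε : 0 < ε₀) (hε' : 0 < ε₂₉) (hB : 0 ≤ B₃) (hB' : 0 ≤ B₃') (ha₀ : 0 < a₀) (ha₁ : 0 < a₁)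
    (h15 : VariationalThm1RegSepCoP7MGB F N (floorGuard F c) (lamDatum F) Dat B₃ a₀ a₁) (hc : c ≤ F.L ^ j)
    (h15G : VariationalThm1GaugeRegSepCoP7MGB F N (F.L ^ j) (floorGuard F c) (lamDatum F) Dat B₃ B₃' a₀ a₁)
    (hcomp : ∀ (p : B12.RunParams) (n : ℕ), n ≤ p.K → Step.InInterval (theta13OfThm1CCMW F N j γ ε₀ ε₂₉ B₃ B₃' a₀ a₁).γ n (gOfRecord₁₃ F N (theta13OfThm1CCMW F N j γ ε₀ ε₂₉ B₃ B₃' a₀ a₁) p) → ∀ m, m < n →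
      (theta13OfThm1CCMW F N j γ ε₀ ε₂₉ B₃ B₃' a₀ a₁).s2.cR * epsOfRecord (theta13OfThm1CCMW F N j γ ε₀ ε₂₉ B₃ B₃' a₀ a₁).ν (gOfRecord₁₃ F N (theta13OfThm1CCMW F N j γ ε₀ ε₂₉ B₃ B₃' a₀ a₁) p) m ≤ 2 * ((theta13OfThm1CCMW F N j γ ε₀ ε₂₉ B₃ B₃' a₀ a₁).s2.cR * epsOfRecord (theta13OfThm1CCMW F N j γ ε₀ ε₂₉ B₃ B₃' a₀ a₁).ν (gOfRecord₁₃ F N (theta13OfThm1CCMW F N j γ ε₀ ε₂₉ B₃ B₃' a₀ a₁) p) (m + 1)))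
    (hcompRev : ∀ (p : B12.RunParams) (n : ℕ), n ≤ p.K → Step.InInterval (theta13OfThm1CCMW F N j γ ε₀ ε₂₉ B₃ B₃' a₀ a₁).γ n (gOfRecord₁₃ F N (theta13OfThm1CCMW F N j γ ε₀ ε₂₉ B₃ B₃' a₀ a₁) p) → ∀ m, m < n →
      (theta13OfThm1CCMW F N j γ ε₀ ε₂₉ B₃ B₃' a₀ a₁).s2.cR * epsOfRecord (theta13OfThm1CCMW F N j γ ε₀ ε₂₉ B₃ B₃' a₀ a₁).ν (gOfRecord₁₃ F N (theta13OfThm1CCMW F N j γ ε₀ ε₂₉ B₃ B₃' a₀ a₁) p) (m + 1) ≤ 2 * ((theta13OfThm1CCMW F N j γ ε₀ ε₂₉ B₃ B₃' a₀ a₁).s2.cR * epsOfRecord (theta13OfThm1CCMW F N j γ ε₀ ε₂₉ B₃ B₃' a₀ a₁).ν (gOfRecord₁₃ F N (theta13OfThm1CCMW F N j γ ε₀ ε₂₉ B₃ B₃' a₀ a₁) p) m))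
    (hDat : ∀ (p : B12.RunParams) (n : ℕ) (s : SeqOfRecord F (theta13OfThm1CCMW F N j γ ε₀ ε₂₉ B₃ B₃' a₀ a₁).ν (theta13OfThm1CCMW F N j γ ε₀ ε₂₉ B₃ B₃' a₀ a₁).τ9.M (gOfRecord₁₃ F N (theta13OfThm1CCMW F N j γ ε₀ ε₂₉ B₃ B₃' a₀ a₁) p) p.K n) (δ : ℕ → ℝ) (W : MSField (F.P p.K) (SU N)),
      n ≤ p.K → Step.InInterval (theta13OfThm1CCMW F N j γ ε₀ ε₂₉ B₃ B₃' a₀ a₁).γ n (gOfRecord₁₃ F N (theta13OfThm1CCMW F N j γ ε₀ ε₂₉ B₃ B₃' a₀ a₁) p) →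
      Sect2.DataSmall7PTop (avOfRecord F N p.K) s.Ω (suppDomOfRecord F (theta13OfThm1CCMW F N j γ ε₀ ε₂₉ B₃ B₃' a₀ a₁).ν p.K s.Ω) n δ W → Dat p.K s.Ω (suppDomOfRecord F (theta13OfThm1CCMW F N j γ ε₀ ε₂₉ B₃ B₃' a₀ a₁).ν p.K s.Ω) n δ W) :
    ∀ (p : B12.RunParams) (n : ℕ), n ≤ p.K → Step.InInterval (theta13OfThm1CCMW F N j γ ε₀ ε₂₉ B₃ B₃' a₀ a₁).γ n (gOfRecord₁₃ F N (theta13OfThm1CCMW F N j γ ε₀ ε₂₉ B₃ B₃' a₀ a₁) p) →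
      ∀ s : SeqOfRecord F (theta13OfThm1CCMW F N j γ ε₀ ε₂₉ B₃ B₃' a₀ a₁).ν (theta13OfThm1CCMW F N j γ ε₀ ε₂₉ B₃ B₃' a₀ a₁).τ9.M (gOfRecord₁₃ F N (theta13OfThm1CCMW F N j γ ε₀ ε₂₉ B₃ B₃' a₀ a₁) p) p.K n, Sect2.SeqSeparated (theta13OfThm1CCMW F N j γ ε₀ ε₂₉ B₃ B₃' a₀ a₁).ν.M₁ s →
      ∀ W : MSField (F.P p.K) (SU N), W ∈ suppOfRecord₁₃P F N (theta13OfThm1CCMW F N j γ ε₀ ε₂₉ B₃ B₃' a₀ a₁) p n s →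
      Sect2.DataSmall7PTop (avOfRecord F N p.K) s.Ω (suppDomOfRecord F (theta13OfThm1CCMW F N j γ ε₀ ε₂₉ B₃ B₃' a₀ a₁).ν p.K s.Ω) n (fun j' => (theta13OfThm1CCMW F N j γ ε₀ ε₂₉ B₃ B₃' a₀ a₁).s2.cR * epsOfRecord (theta13OfThm1CCMW F N j γ ε₀ ε₂₉ B₃ B₃' a₀ a₁).ν (gOfRecord₁₃ F N (theta13OfThm1CCMW F N j γ ε₀ ε₂₉ B₃ B₃' a₀ a₁) p) j') W →
      ∀ j', 1 ≤ j' → j' ≤ n → ∀ X : (Sect2.domSys (F.P p.K) (theta13OfThm1CCMW F N j γ ε₀ ε₂₉ B₃ B₃' a₀ a₁).τ9.M j').Dom,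
      (Sect2.domSites (F.P p.K) (theta13OfThm1CCMW F N j γ ε₀ ε₂₉ B₃ B₃' a₀ a₁).τ9.M j' X ⊆ s.Λ j' →
        Sect2.ofBackgroundC (settingOfRecord₁₃ F N (theta13OfThm1CCMW F N j γ ε₀ ε₂₉ B₃ B₃' a₀ a₁) p).ι (UbgOfRecord₁₃CoP F N (theta13OfThm1CCMW F N j γ ε₀ ε₂₉ B₃ B₃' a₀ a₁) p n s W) ∈
          Sect2.spaceI (settingOfRecord₁₃ F N (theta13OfThm1CCMW F N j γ ε₀ ε₂₉ B₃ B₃' a₀ a₁) p) ((theta13OfThm1CCMW F N j γ ε₀ ε₂₉ B₃ B₃' a₀ a₁).Rz p.K) (theta13OfThm1CCMW F N j γ ε₀ ε₂₉ B₃ B₃' a₀ a₁).τ9.M j' (Sect2.domSites (F.P p.K) (theta13OfThm1CCMW F N j γ ε₀ ε₂₉ B₃ B₃' a₀ a₁).τ9.M j' X)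
            ((settingOfRecord₁₃ F N (theta13OfThm1CCMW F N j γ ε₀ ε₂₉ B₃ B₃' a₀ a₁) p).lf.alpha0 ((settingOfRecord₁₃ F N (theta13OfThm1CCMW F N j γ ε₀ ε₂₉ B₃ B₃' a₀ a₁) p).flow.g j')) ((settingOfRecord₁₃ F N (theta13OfThm1CCMW F N j γ ε₀ ε₂₉ B₃ B₃' a₀ a₁) p).lf.alpha1 ((settingOfRecord₁₃ F N (theta13OfThm1CCMW F N j γ ε₀ ε₂₉ B₃ B₃' a₀ a₁) p).flow.g j'))) ∧
      (Sect2.admB (F.P p.K) (theta13OfThm1CCMW F N j γ ε₀ ε₂₉ B₃ B₃' a₀ a₁).ν (theta13OfThm1CCMW F N j γ ε₀ ε₂₉ B₃ B₃' a₀ a₁).τ9.M (gOfRecord₁₃ F N (theta13OfThm1CCMW F N j γ ε₀ ε₂₉ B₃ B₃' a₀ a₁) p) s.Ω s.Λ j' (Sect2.domSites (F.P p.K) (theta13OfThm1CCMW F N j γ ε₀ ε₂₉ B₃ B₃' a₀ a₁).τ9.M j' X) = true →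
        Sect2.ofBackgroundC (settingOfRecord₁₃ F N (theta13OfThm1CCMW F N j γ ε₀ ε₂₉ B₃ B₃' a₀ a₁) p).ι (UbgOfRecord₁₃CoP F N (theta13OfThm1CCMW F N j γ ε₀ ε₂₉ B₃ B₃' a₀ a₁) p n s W) ∈
          Sect2.spaceMS (settingOfRecord₁₃ F N (theta13OfThm1CCMW F N j γ ε₀ ε₂₉ B₃ B₃' a₀ a₁) p) ((theta13OfThm1CCMW F N j γ ε₀ ε₂₉ B₃ B₃' a₀ a₁).Rz p.K) (theta13OfThm1CCMW F N j γ ε₀ ε₂₉ B₃ B₃' a₀ a₁).τ9.M j' (Sect2.domSites (F.P p.K) (theta13OfThm1CCMW F N j γ ε₀ ε₂₉ B₃ B₃' a₀ a₁).τ9.M j' X) s.Ω) :=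
  fun p n hn hw s hsep W hW h7 =>
    bgSepCoPAt_theta13OfThm1CCMW_of_thm1RegSepCoP7MGB_of_thm1GaugeGB_of_hseam_of_hjm hγ0 hγ hjm hε hε' hB hB' ha₀ ha₁ h15 h15G
    (fun p n => UbgMSCoPOfRecordB F N (theta13OfThm1CCMW F N j γ ε₀ ε₂₉ B₃ B₃' a₀ a₁).ν (theta13OfThm1CCMW F N j γ ε₀ ε₂₉ B₃ B₃' a₀ a₁).τ9.M (gOfRecord₁₃ F N (theta13OfThm1CCMW F N j γ ε₀ ε₂₉ B₃ B₃' a₀ a₁) p) p.K n)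
    (fun p n s W => ubgMSCoPOfRecordB_dichotomy (theta13OfThm1CCMW F N j γ ε₀ ε₂₉ B₃ B₃' a₀ a₁).ν (theta13OfThm1CCMW F N j γ ε₀ ε₂₉ B₃ B₃' a₀ a₁).τ9.M (gOfRecord₁₃ F N (theta13OfThm1CCMW F N j γ ε₀ ε₂₉ B₃ B₃' a₀ a₁) p) p.K n s W) (fun p n => UbgOfRecord₁₃CoP_succ F N (theta13OfThm1CCMW F N j γ ε₀ ε₂₉ B₃ B₃' a₀ a₁) p n)
    (fun _ _ _ _ _ => show c ≤ (theta13OfThm1CCMW F N j γ ε₀ ε₂₉ B₃ B₃' a₀ a₁).ν.M₁ by rw [theta13OfThm1CCMW_M₁]; exact hc) hcomp hcompRev p n hn hw s hsep W hW (hDat p n s _ W hn hw h7)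

/-- **§3 ★★★ ROW P11 IN ITS OWN CURRENCY `BgProvisoΛ … (suppOfRecord₁₃SepCoP …) (UbgOfRecord₁₃CoP …)` AT θ₁₅ᶜᶜᴹᵂ(j; γ) ON EVERY WINDOW RUN — NO RUN GUARD, NO GEOMETRIC
HYPOTHESIS** (p623895 §6 ∘ §1): the `hbg` of dag-n11-w1's `…OfBgFact(s)` consumers at the witness, non-wrapping families.  CONDITIONAL; nothing of Bałaban asserted.
[cite: Balaban1988Convergent, (2.28) p.259, (2.18) p.257, Thm 1 p.262; Balaban1985Variational, (6)–(7) p.278, Thm 1 (8)–(9) p.279; Balaban1985RegularSpaces, (1.3)–(1.6) p.77] -/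
theorem bgProvisoΛ_theta13OfThm1CCMW_of_thm1GaugeR_of_hcomp_of_hjm (hγ0 : 0 < γ) (hγ : γ ≤ 1 / 2) (hjm : j + 1 ≤ F.m) (hε : 0 < ε₀) (hε' : 0 < ε₂₉) (hB : 0 ≤ B₃) (hB' : 0 ≤ B₃') (ha₀ : 0 < a₀) (ha₁ : 0 < a₁)
    (h15 : VariationalThm1RegSepCoP7MGB F N (floorGuard F c) (lamDatum F) Dat B₃ a₀ a₁) (hc : c ≤ F.L ^ j)
    (h15G : VariationalThm1GaugeRegSepCoP7MGB F N (F.L ^ j) (floorGuard F c) (lamDatum F) Dat B₃ B₃' a₀ a₁)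
    (hcomp : ∀ (p : B12.RunParams) (n : ℕ), n ≤ p.K → Step.InInterval (theta13OfThm1CCMW F N j γ ε₀ ε₂₉ B₃ B₃' a₀ a₁).γ n (gOfRecord₁₃ F N (theta13OfThm1CCMW F N j γ ε₀ ε₂₉ B₃ B₃' a₀ a₁) p) → ∀ m, m < n →
      (theta13OfThm1CCMW F N j γ ε₀ ε₂₉ B₃ B₃' a₀ a₁).s2.cR * epsOfRecord (theta13OfThm1CCMW F N j γ ε₀ ε₂₉ B₃ B₃' a₀ a₁).ν (gOfRecord₁₃ F N (theta13OfThm1CCMW F N j γ ε₀ ε₂₉ B₃ B₃' a₀ a₁) p) m ≤ 2 * ((theta13OfThm1CCMW F N j γ ε₀ ε₂₉ B₃ B₃' a₀ a₁).s2.cR * epsOfRecord (theta13OfThm1CCMW F N j γ ε₀ ε₂₉ B₃ B₃' a₀ a₁).ν (gOfRecord₁₃ F N (theta13OfThm1CCMW F N j γ ε₀ ε₂₉ B₃ B₃' a₀ a₁) p) (m + 1)))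
    (hcompRev : ∀ (p : B12.RunParams) (n : ℕ), n ≤ p.K → Step.InInterval (theta13OfThm1CCMW F N j γ ε₀ ε₂₉ B₃ B₃' a₀ a₁).γ n (gOfRecord₁₃ F N (theta13OfThm1CCMW F N j γ ε₀ ε₂₉ B₃ B₃' a₀ a₁) p) → ∀ m, m < n →
      (theta13OfThm1CCMW F N j γ ε₀ ε₂₉ B₃ B₃' a₀ a₁).s2.cR * epsOfRecord (theta13OfThm1CCMW F N j γ ε₀ ε₂₉ B₃ B₃' a₀ a₁).ν (gOfRecord₁₃ F N (theta13OfThm1CCMW F N j γ ε₀ ε₂₉ B₃ B₃' a₀ a₁) p) (m + 1) ≤ 2 * ((theta13OfThm1CCMW F N j γ ε₀ ε₂₉ B₃ B₃' a₀ a₁).s2.cR * epsOfRecord (theta13OfThm1CCMW F N j γ ε₀ ε₂₉ B₃ B₃' a₀ a₁).ν (gOfRecord₁₃ F N (theta13OfThm1CCMW F N j γ ε₀ ε₂₉ B₃ B₃' a₀ a₁) p) m))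
    (hDat : ∀ (p : B12.RunParams) (n : ℕ) (s : SeqOfRecord F (theta13OfThm1CCMW F N j γ ε₀ ε₂₉ B₃ B₃' a₀ a₁).ν (theta13OfThm1CCMW F N j γ ε₀ ε₂₉ B₃ B₃' a₀ a₁).τ9.M (gOfRecord₁₃ F N (theta13OfThm1CCMW F N j γ ε₀ ε₂₉ B₃ B₃' a₀ a₁) p) p.K n) (δ : ℕ → ℝ) (W : MSField (F.P p.K) (SU N)),
      n ≤ p.K → Step.InInterval (theta13OfThm1CCMW F N j γ ε₀ ε₂₉ B₃ B₃' a₀ a₁).γ n (gOfRecord₁₃ F N (theta13OfThm1CCMW F N j γ ε₀ ε₂₉ B₃ B₃' a₀ a₁) p) →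
      Sect2.DataSmall7PTop (avOfRecord F N p.K) s.Ω (suppDomOfRecord F (theta13OfThm1CCMW F N j γ ε₀ ε₂₉ B₃ B₃' a₀ a₁).ν p.K s.Ω) n δ W → Dat p.K s.Ω (suppDomOfRecord F (theta13OfThm1CCMW F N j γ ε₀ ε₂₉ B₃ B₃' a₀ a₁).ν p.K s.Ω) n δ W) :
    ∀ (p : B12.RunParams) (n : ℕ), n ≤ p.K → Step.InInterval (theta13OfThm1CCMW F N j γ ε₀ ε₂₉ B₃ B₃' a₀ a₁).γ n (gOfRecord₁₃ F N (theta13OfThm1CCMW F N j γ ε₀ ε₂₉ B₃ B₃' a₀ a₁) p) →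
      BgProvisoΛ F N p.K (settingOfRecord₁₃ F N (theta13OfThm1CCMW F N j γ ε₀ ε₂₉ B₃ B₃' a₀ a₁) p) ((theta13OfThm1CCMW F N j γ ε₀ ε₂₉ B₃ B₃' a₀ a₁).Rz p.K) (theta13OfThm1CCMW F N j γ ε₀ ε₂₉ B₃ B₃' a₀ a₁).τ9.M n
        (suppOfRecord₁₃SepCoP F N (theta13OfThm1CCMW F N j γ ε₀ ε₂₉ B₃ B₃' a₀ a₁) p n) (UbgOfRecord₁₃CoP F N (theta13OfThm1CCMW F N j γ ε₀ ε₂₉ B₃ B₃' a₀ a₁) p n) :=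
  bgProvisoΛ_theta13OfThm1CCMW_of_thm1RegSepCoP7MGB_of_thm1GaugeGB_of_hseam_of_hjm hγ0 hγ hjm hε hε' hB hB' ha₀ ha₁ h15 h15G
    (fun p n => UbgMSCoPOfRecordB F N (theta13OfThm1CCMW F N j γ ε₀ ε₂₉ B₃ B₃' a₀ a₁).ν (theta13OfThm1CCMW F N j γ ε₀ ε₂₉ B₃ B₃' a₀ a₁).τ9.M (gOfRecord₁₃ F N (theta13OfThm1CCMW F N j γ ε₀ ε₂₉ B₃ B₃' a₀ a₁) p) p.K n)
    (fun p n s W => ubgMSCoPOfRecordB_dichotomy (theta13OfThm1CCMW F N j γ ε₀ ε₂₉ B₃ B₃' a₀ a₁).ν (theta13OfThm1CCMW F N j γ ε₀ ε₂₉ B₃ B₃' a₀ a₁).τ9.M (gOfRecord₁₃ F N (theta13OfThm1CCMW F N j γ ε₀ ε₂₉ B₃ B₃' a₀ a₁) p) p.K n s W) (fun p n => UbgOfRecord₁₃CoP_succ F N (theta13OfThm1CCMW F N j γ ε₀ ε₂₉ B₃ B₃' a₀ a₁) p n)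
    (fun _ _ _ _ _ => show c ≤ (theta13OfThm1CCMW F N j γ ε₀ ε₂₉ B₃ B₃' a₀ a₁).ν.M₁ by rw [theta13OfThm1CCMW_M₁]; exact hc) hDat hcomp hcompRev

end Summit.QuantumFields.YangMills.Theorems.BalabanUVNodesN11BgRowGaugeRAtWitnessOfPowMB

end
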